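import Literature.MathematicalPhysics.QuantumFieldTheory.Balaban1983to89.B8Thm4ZdGF3PMapGammaPrime
import Literature.MathematicalPhysics.QuantumFieldTheory.Balaban1983to89.B8Eq142KLevelLocalGammaPrime
import Literature.MathematicalPhysics.QuantumFieldTheory.Balaban1983to89.B8TowerBondsPrinted
import Literature.MathematicalPhysics.QuantumFieldTheory.Balaban1983to89.B8Ineq166Univ
import Literature.MathematicalPhysics.QuantumFieldTheory.Balaban1983to89.B8Ineq165AllLevels

/-!
# `Balaban1983to89.B8Thm2ZdGF3PMapGammaPrime` — [Balaban1985RegularSpaces] THEOREM 2 (p. 83) AS `B8.Thm2Printed` ON ANY INDEX-MAPPED `Ω₀ = ℤᵈ` SUB-FAMILY OF THE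
# P-CARRIER `B8LeafModelZd3P.zdGF3P` ∕ `zdGF3HP` OVER THE γ′ (ONE-END-POINT, SOURCED) SOCKET FAMILY OF RECORD — the (D5″) item of the §n05 γ chain:
# Theorem 2 ⇐ Theorem 4 (`B8Thm4ZdGF3PMapGammaPrime.thm4Body_zdGF3HP_mapJ_γ'`, dag-n05-d's γ′ core at a zero source) + Proposition 3 on the carrier
# (a HYPOTHESIS on the image family — dag-n05-d's `prop3Printed_zdGF3P_map_γ`) + (1.65) (`B8Ineq166Univ`); sockets index-generic along `ι`

statement-level skeleton of published theorems with citation tags; proofs where landed; nothing here is a claim about the Yang–Mills mass gap.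
T. Bałaban, *Spaces of regular gauge field configurations on a lattice and gauge fixing conditions*, Commun. Math. Phys. **99** (1985) 75–102
`[Balaban1985RegularSpaces]` ("B8"; journal page = PDF page + 74): Thm 2 p. 83, Prop. 3 p. 87, Thm 4 p. 88, (1.65)–(1.67) pp. 87–88, p. 77.

## WHY THIS FILE (cell `pub-ymgap`, HUMAN RULING D-0149 width push; seat `pub-ymgap-dag-n05-w2`, WIDTH SEAT 2 of 4 on NODE n05 = [B8]; count-neutral)

The INDEX-MAPPED edition of this seat's `B8Thm2ZdGF3PGammaPrime.thm2Printed_zdGF3HP_univ_γ'` (p593211).  That theorem asks the tower law at every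
truncation for EVERY `Ω₀ = ℤᵈ` member of `ZdIdx d L`; a bare `ZdIdx` member does not carry it (its `htower` is the top truncation only) — NODE 00's
law members do (`IdxB8Sub.tower_all`).  So the form the record's knits can discharge is the one over an index map `ι : J → ZdIdx d L` into
`Ω₀ = ℤᵈ` members, with the tower laws asked AT `ι a` only — exactly as dag-n05-d's `thm4Core_zdGF3HP_map_lanE_γ'` and this seat's
`B8Thm4ZdGF3PMapGammaPrime.thm4Printed_zdGF3HP_mapJ_γ'` do — with, moreover (dag-n05-d's A6 point (3)), the four sourced SOCKETS and the zero-source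
triple stated INDEX-GENERICALLY (`∀ a : J` at `ι a`, not `∀ i : ZdIdx d L`: the record serves them at its law members only).  THIS FILE is that form, same
proof member by member: ★★ `thm2Printed_zdGF3HP_mapJ_γ'`.  Sockets = dag-n05-d's MAP core binders (`thm4Core_zdGF3HP_map_lanE_γ'`, p592066) verbatim at
`B₀ := inp.B₀`, `B₀′ := inp.B₀′`, zero source `(φ₀, hAdm₀, hLan₀)`, PROPOSITION 3 on the carrier ON THE IMAGE FAMILY `zdGF3P ∘ ι` as the hypothesis `hP3` (dag-n05-d's
`prop3Printed_zdGF3P_map_γ`; A6: the all-`ZdIdx` form would only be suppliable from a b9 socket at every `ZdIdx` datum, vacuously), Theorem 4 := `B8Thm4ZdGF3PMapGammaPrime.thm4Body_zdGF3HP_mapJ_γ'` at the shifted pair.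

## HONEST SCOPE

An assembly BY NAME; NO estimate proved anew (the arithmetic of the shifted pair and of (1.61) at `B₈` only); the four sourced sockets, the zero-source
triple, the tower laws and PROPOSITION 3 on the carrier are HYPOTHESES (A6: providers = dag-n05-w4's γ′ chain modulo [4]'s letters; m = 0 inhabited by
the tree's `Ω₀ = ℤᵈ` suppliers, m ≥ 1 = N06 content, OPEN; no joint-satisfiability claim).  `d, L ≥ 2`; `T_η ↦ ℤᵈ`; `≤` for print's `<`.  Count-neutral;
N05 NOT discharged; no count claim; one finite `T⁴` programme at fixed `ε`, Bałaban AS PRINTED; the Yang–Mills mass gap (Clay) is NOT proved by any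
of this — R4 closes the conditional finite-𝕋⁴ rung `BalabanLadder.UV` only; nothing continuum ∕ ℝ⁴ ∕ OS.  No `sorry`, no `axiom`, no definition,
no `instance`.  Unit `pub-ymgap-dag-n05-w2` (g0), 2026-08-28.

[cite: Balaban1985RegularSpaces, Thm 2 (1.36)–(1.39) p.83, Thm 4 p.88, Prop. 3 p.87, (1.65)–(1.67) pp.87–88, (1.35)∕(1.37) p.82, p.77, Thm 8 (1.146) p.101]
-/

noncomputable section

open NormedSpace
namespace Literature.MathematicalPhysics.QuantumFieldTheory.Balaban1983to89.B8Thm2ZdGF3PMapGammaPrime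

open Complex (I)
open MatrixLog B7Prop1Explicit B7Prop2Explicit B7Prop1Local B7Eq92Concrete
open B7Prop2Explicit (C0 c2')
open B7Prop3Flat (c3)
open B8Ineq132 (covDerivFwd InAk BondTouches)
open B8Eq119TwistedAxial (Restr129 InAx)
open B8Eq184Proof (gaugeExp cfgExp)
open B8Lemma1NonAbelian (mulCfg)
open B8Eq140Level (SideTouches)
open B8Eq146AExpansion (iEta)
open B7Prop4GeneralLevels (linCovIter)
open B8Eq155JBound (Jcur wsup)
open B8ScaledSupNorm (bondNorm msup)
open B8Thm2LogB (blockTop)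
open B8Ineq130 (tlo thi)
open B8Eq138LandauZd (IsLandau138W logCfg)
open B8Prop3GaugeFixedKLevel (mem_unitaryUnits_of_mgauge_eq mulCfg_eq_gaugeAct_of_mgauge_eq)
open B8Thm4AtLandau138 (mgauge_mgauge_inv)
open B8Thm4Windows (thm4_windows thm4_windows_extra)
open B8Thm4ExistsConcreteGamma (thm4_windows_γ)
open B8LeafModelZd (ZdIdx)
open B8LeafModelZd3 (mlogCfg mlogCfg_spec)
open B8LeafModelZd3P (zdGF3P zdGF3HP)
open B8TowerBondsPrinted (towerBondsP)
open B9SupplySockB9P3ZdBeta (CrossB)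
open B8Ineq166Univ (norm_pert_sub_one_le_univ)
open B8Thm4ZdGF3PMapGammaPrime (thm4Body_zdGF3HP_mapJ_γ')
open B7Prop4GeneralLevels (logCovIter)

-- `Site` alone could resolve to the torus sites of `Setup.lean`; re-export the `ℤ^d` sites of `B7Prop1Explicit`.
export B7Prop1Explicit (Site)

variable {d : ℕ}

section Thm2

variable {𝔸 : Type} [CStarAlgebra 𝔸] [Nontrivial 𝔸]

/-- ★★ **`B8.Thm2Printed` ON ANY INDEX-MAPPED `Ω₀ = ℤᵈ` SUB-FAMILY `ι : J → ZdIdx d L` OF THE P-CARRIER `zdGF3HP` (the record's H-twin; the `zdGF3P` face is the same term, `toGFData` agree by `rfl`), γ′ SOCKET FAMILY, ZERO SOURCE** (Theorem 2, p. 83: «there exist constants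
B₁, B₂(β₀), c₁ … exactly one gauge transformation u satisfying (1.29) and (1.36)–(1.39)»): this seat's `B8Thm2ZdGF3PGammaPrime.thm2Printed_zdGF3HP_univ_γ'` MEMBER BY MEMBER along `ι` (sockets, zero source and tower laws asked at `ι a` only), itself `B8LeafModelZd3PThm2Gamma.thm2Printed_zd3P_univ_γ`
LINE BY LINE with the Theorem-4 step := `B8Thm4ZdGF3PMapGammaPrime.thm4Body_zdGF3HP_mapJ_γ'` (dag-n05-d's γ′ core at a zero source; constant `5dL·B₈`,
no bridge): for `d, L ≥ 2`, the leaf's `inp : B8.B9Inputs`, `B₀β > 0`, Prop. 5's radius `cu > 0`, the providers' threshold `cP > 0`, source constants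
`γ′ ≥ 0`, `B₈ ≥ inp.B₀` with `5dL·inp.B₀ + 2γ′·inp.B₀ ≤ 5dL·B₈`, `2 ≤ 5dL·B₈`, any Hölder data `β, len` — MODULO the γ′ socket family of record
(`SP5base` ∕ `SP5` ∕ `SH59src` ∕ `SP5u`, sourced, one-end-point (1.35) antecedent), a zero source `(φ₀, hAdm₀, hLan₀)`, the members' tower laws, and
PROPOSITION 3 on the image family `zdGF3P ∘ ι` (`hP3`, dag-n05-d's `prop3Printed_zdGF3P_map_γ`, any `C₂ ≤ 2097152(d+1)²L²`).  Proof: Theorem 4 at the shifted pair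
`(α₀, α″ = 11d²(α₀ + α₁) + α₁)`; (1.66)₀ from (1.33)–(1.35) by (1.65) (`B8Ineq166Univ.norm_pert_sub_one_le_univ`, fed the box-form letter the
one-end-point letter implies); (1.37) AT PRINT's `α₁` by this seat's `B8Eq142KLevelLocalGammaPrime.H42_of_inAx_γ'` fed the member's letter verbatim;
(1.36)∕(1.39) by `hP3` at `(α₀, α″, α₂ := 5dL·B₈·(α₀ + α″))`, its (1.61) from the γ window at `B₈`; uniqueness = Theorem 4's ((1.36) at
`B₁(α₀ + α₁) = 5dL·inp.B₀·(α₀ + α″) ≤ 5dL·B₈·(α₀ + α″)` is (1.62) there, (1.37) monotone in `α₁`).  Constants `B₁ = 5dL·inp.B₀·(1 + 11d²)`,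
`B₂ = 5dL·B₀β·(1 + 11d²)`, ONE threshold.
[cite: Balaban1985RegularSpaces, Thm 2 (1.36)–(1.39) p.83, Thm 4 p.88, Prop. 3 p.87, (1.65)–(1.67) pp.87–88, (1.35)∕(1.37) p.82, p.77, Thm 8 (1.146) p.101] -/
theorem thm2Printed_zdGF3HP_mapJ_γ' (hd2 : 2 ≤ d) {L : ℕ} (hL : 2 ≤ L) {β : ℝ} {len : Site d → ℝ} (inp : B8.B9Inputs)
    {B₀β cu cP C₂ : ℝ} (hB₀β : 0 < B₀β) (hcu : 0 < cu) (hcP : 0 < cP) (hC₂ : C₂ ≤ 2097152 * ((d : ℝ) + 1) ^ 2 * (L : ℝ) ^ 2)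
    -- THE γ′ SOCKET FAMILY OF RECORD ALONG AN INDEX MAP `ι : J → ZdIdx d L` (dag-n05-d's `B8Thm4CoreZdGF3HPLanEGamma.thm4Core_zdGF3HP_map_lanE_γ'`,
    -- verbatim at `B₀ := inp.B₀`, `B₀′ := inp.B₀′`): source data `Φ, γ′, B₈, Adm a, LanF a` and the four sourced sockets AT `ι a` (one-end-point (1.35) antecedent)
    {Φ : Type*} {γ' B₈ : ℝ} (hγ' : 0 ≤ γ') (hB₈ : 0 < B₈) (hB₀8 : inp.B₀ ≤ B₈) (hB : 2 ≤ 5 * (d : ℝ) * L * B₈)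
    (hγB : 5 * (d : ℝ) * L * inp.B₀ + 2 * (γ' * inp.B₀) ≤ 5 * (d : ℝ) * L * B₈)
    {J : Type} (ι : J → ZdIdx d L)
    (Adm : J → Φ → (Site d → Fin d → 𝔸ˣ) → ℝ → ℝ → Prop)
    (LanF : J → (Site d → Fin d → 𝔸ˣ) → Φ → ℕ → (Site d → Fin d → 𝔸ˣ) → Prop)
    (SP5base : ∀ a : J, ∀ α₀ α₁ : ℝ, 0 < α₀ → 0 < α₁ → α₀ + α₁ ≤ cP →
      ∀ U₀ U' : Site d → Fin d → 𝔸ˣ, (∀ x κ, U₀ x κ ∈ unitaryUnits 𝔸) → (∀ x κ, U' x κ ∈ unitaryUnits 𝔸) →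
      ∀ φ : Φ, Adm a φ U₀ α₀ α₁ →
      InAk L (ι a).k (ι a).η α₀ (ι a).Ω U₀ → InAk L (ι a).k (ι a).η α₀ (ι a).Ω (mulCfg U' U₀) → (∀ m, m ≤ (ι a).k → InAx L m ((ι a).Λs m) U₀ (mulCfg U' U₀)) →
      (∀ j, j ≤ (ι a).k → ∀ (z : Site d) (μ : Fin d),
        ((∀ x, InBox (tlo L z j) (thi L z j) x → x ∈ (ι a).Ω j) ∨ (∀ x, InBox (tlo L (z + e μ) j) (thi L (z + e μ) j) x → x ∈ (ι a).Ω j)) →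
        ‖(avgIter L (mulCfg U' U₀) j z μ : 𝔸) - (avgIter L U₀ j z μ : 𝔸)‖ ≤ α₁) →
      (∀ b ∈ {b : Site d × Fin d | SideTouches ((ι a).Ω 0) b.1 b.2}, ‖((U' b.1 b.2 : 𝔸ˣ) : 𝔸) - 1‖ ≤ α₁) →
      (∃ (v : Site d → 𝔸ˣ) (lam : Site d → 𝔸), (∀ x, v x ∈ unitaryUnits 𝔸) ∧ (∀ x, x ∉ (ι a).Ω 0 → v x = 1) ∧
        (∀ j, j ≤ 1 → ∀ b ∈ {b : Site d × Fin d | SideTouches ((ι a).Ω j) b.1 b.2}, (v b.1 : 𝔸) = ((gaugeExp lam b.1 : 𝔸ˣ) : 𝔸) ∧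
        (v (b.1 + e b.2) : 𝔸) = ((gaugeExp lam (b.1 + e b.2) : 𝔸ˣ) : 𝔸)) ∧
        (∀ j, j ≤ 1 → ∀ b ∈ {b : Site d × Fin d | SideTouches ((ι a).Ω j) b.1 b.2},
        ‖lam b.1‖ ≤ (8 * inp.B₀' * (5 * (d : ℝ) * L * B₈) * (α₀ + α₁)) ∧ ((L : ℝ) ^ j * (ι a).η) * ‖covDerivFwd (ι a).η U₀ b.2 lam b.1‖ ≤ (8 * inp.B₀' * (5 * (d : ℝ) * L * B₈) * (α₀ + α₁))) ∧
        LanF a U₀ φ 1 (mgauge U₀ v⁻¹ U') ∧ Restr129 L 1 ((ι a).Λs 1) U₀ ((1 : Site d → 𝔸ˣ) * v)))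
    (SP5 : ∀ a : J, ∀ α₀ α₁ : ℝ, 0 < α₀ → 0 < α₁ → α₀ + α₁ ≤ cP →
      ∀ U₀ U' : Site d → Fin d → 𝔸ˣ, (∀ x κ, U₀ x κ ∈ unitaryUnits 𝔸) → (∀ x κ, U' x κ ∈ unitaryUnits 𝔸) →
      ∀ φ : Φ, Adm a φ U₀ α₀ α₁ →
      InAk L (ι a).k (ι a).η α₀ (ι a).Ω U₀ → InAk L (ι a).k (ι a).η α₀ (ι a).Ω (mulCfg U' U₀) → (∀ m, m ≤ (ι a).k → InAx L m ((ι a).Λs m) U₀ (mulCfg U' U₀)) →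
      (∀ j, j ≤ (ι a).k → ∀ (z : Site d) (μ : Fin d),
        ((∀ x, InBox (tlo L z j) (thi L z j) x → x ∈ (ι a).Ω j) ∨ (∀ x, InBox (tlo L (z + e μ) j) (thi L (z + e μ) j) x → x ∈ (ι a).Ω j)) →
        ‖(avgIter L (mulCfg U' U₀) j z μ : 𝔸) - (avgIter L U₀ j z μ : 𝔸)‖ ≤ α₁) →
      (∀ b ∈ {b : Site d × Fin d | SideTouches ((ι a).Ω 0) b.1 b.2}, ‖((U' b.1 b.2 : 𝔸ˣ) : 𝔸) - 1‖ ≤ α₁) →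
      (∀ m, 1 ≤ m → m < (ι a).k → ∀ (u₁ : Site d → 𝔸ˣ) (U₁ : Site d → Fin d → 𝔸ˣ) (A : Site d → Fin d → 𝔸),
        (∀ x, u₁ x ∈ unitaryUnits 𝔸) → (∀ x, x ∉ (ι a).Ω 0 → u₁ x = 1) → mgauge U₀ u₁ U₁ = U' → Restr129 L m ((ι a).Λs m) U₀ u₁ →
        LanF a U₀ φ m U₁ →
        (∀ j, j ≤ m → ∀ b ∈ {b : Site d × Fin d | SideTouches ((ι a).Ω j) b.1 b.2},
        U₁ b.1 b.2 = cfgExp (ι a).η A b.1 b.2 ∧ IsSelfAdjoint (A b.1 b.2) ∧ ‖A b.1 b.2‖ ≤ (5 * (d : ℝ) * L * B₈ * (α₀ + α₁)) * ((L : ℝ) ^ j * (ι a).η)⁻¹) →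
        ∃ (v : Site d → 𝔸ˣ) (lam : Site d → 𝔸), (∀ x, v x ∈ unitaryUnits 𝔸) ∧ (∀ x, x ∉ (ι a).Ω 0 → v x = 1) ∧
        (∀ j, j ≤ m + 1 → ∀ b ∈ {b : Site d × Fin d | SideTouches ((ι a).Ω j) b.1 b.2}, (v b.1 : 𝔸) = ((gaugeExp lam b.1 : 𝔸ˣ) : 𝔸) ∧
        (v (b.1 + e b.2) : 𝔸) = ((gaugeExp lam (b.1 + e b.2) : 𝔸ˣ) : 𝔸)) ∧
        (∀ j, j ≤ m + 1 → ∀ b ∈ {b : Site d × Fin d | SideTouches ((ι a).Ω j) b.1 b.2},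
        ‖lam b.1‖ ≤ (8 * inp.B₀' * (5 * (d : ℝ) * L * B₈) * (α₀ + α₁)) ∧ ((L : ℝ) ^ j * (ι a).η) * ‖covDerivFwd (ι a).η U₀ b.2 lam b.1‖ ≤ (8 * inp.B₀' * (5 * (d : ℝ) * L * B₈) * (α₀ + α₁))) ∧
        LanF a U₀ φ (m + 1) (mgauge U₀ v⁻¹ U₁) ∧ Restr129 L (m + 1) ((ι a).Λs (m + 1)) U₀ (u₁ * v)))
    (SH59src : ∀ a : J, ∀ α₀ α₁ : ℝ, 0 < α₀ → 0 < α₁ → α₀ + α₁ ≤ cP →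
      ∀ U₀ U' : Site d → Fin d → 𝔸ˣ, (∀ x κ, U₀ x κ ∈ unitaryUnits 𝔸) → (∀ x κ, U' x κ ∈ unitaryUnits 𝔸) →
      ∀ φ : Φ, Adm a φ U₀ α₀ α₁ →
      InAk L (ι a).k (ι a).η α₀ (ι a).Ω U₀ → InAk L (ι a).k (ι a).η α₀ (ι a).Ω (mulCfg U' U₀) → (∀ m, m ≤ (ι a).k → InAx L m ((ι a).Λs m) U₀ (mulCfg U' U₀)) →
      (∀ j, j ≤ (ι a).k → ∀ (z : Site d) (μ : Fin d),
        ((∀ x, InBox (tlo L z j) (thi L z j) x → x ∈ (ι a).Ω j) ∨ (∀ x, InBox (tlo L (z + e μ) j) (thi L (z + e μ) j) x → x ∈ (ι a).Ω j)) →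
        ‖(avgIter L (mulCfg U' U₀) j z μ : 𝔸) - (avgIter L U₀ j z μ : 𝔸)‖ ≤ α₁) →
      (∀ b ∈ {b : Site d × Fin d | SideTouches ((ι a).Ω 0) b.1 b.2}, ‖((U' b.1 b.2 : 𝔸ˣ) : 𝔸) - 1‖ ≤ α₁) →
      (∀ m, 1 ≤ m → m ≤ (ι a).k → ∀ (u : Site d → 𝔸ˣ) (W : Site d → Fin d → 𝔸ˣ) (A' : Site d → Fin d → 𝔸),
        (∀ x, u x ∈ unitaryUnits 𝔸) → mgauge U₀ u W = U' → Restr129 L m ((ι a).Λs m) U₀ u → LanF a U₀ φ m W →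
        (∀ y τ, IsSelfAdjoint (A' y τ)) →
        (∀ j, j ≤ m → ∀ y τ, SideTouches ((ι a).Ω j) y τ →
        W y τ = cfgExp (ι a).η A' y τ ∧ ‖A' y τ‖ ≤ (2 * (L * (5 * (d : ℝ) * L * B₈ * (α₀ + α₁))) + 8 * (8 * inp.B₀' * (5 * (d : ℝ) * L * B₈) * (α₀ + α₁))) * ((L : ℝ) ^ j * (ι a).η)⁻¹) →
        (∀ y τ, (∀ j, j ≤ m → ¬ SideTouches ((ι a).Ω j) y τ) → A' y τ = 0) →
        msup L m (ι a).η (-(1 : ℝ)) (fun j (b : Site d × Fin d) => SideTouches ((ι a).Ω j) b.1 b.2) (fun b => A' b.1 b.2)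
        ≤ inp.B₀ * (bondNorm L m (ι a).η (-(3 : ℝ)) (ι a).Ω (fun x μ => Jcur (ι a).η U₀ A' μ x)
        + wsup 1 (fun p : {p : ℕ × (Site d × Fin d) // p.1 ≤ m ∧ p.2 ∈ towerBondsP L (ι a).Ω ((ι a).Λs m) p.1} =>
        linCovIter L U₀ (iEta (ι a).η A') p.1.1 p.1.2.1 p.1.2.2)) + γ' * inp.B₀ * (α₀ + α₁) ∧
        msup L m (ι a).η (-(2 : ℝ)) (fun j (t : Fin d × Fin d × Site d) => SideTouches ((ι a).Ω j) t.2.2 t.2.1)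
        (fun t => covDerivFwd (ι a).η U₀ t.1 (fun z => A' z t.2.1) t.2.2)
        ≤ inp.B₀ * (bondNorm L m (ι a).η (-(3 : ℝ)) (ι a).Ω (fun x μ => Jcur (ι a).η U₀ A' μ x)
        + wsup 1 (fun p : {p : ℕ × (Site d × Fin d) // p.1 ≤ m ∧ p.2 ∈ towerBondsP L (ι a).Ω ((ι a).Λs m) p.1} =>
        linCovIter L U₀ (iEta (ι a).η A') p.1.1 p.1.2.1 p.1.2.2)) + γ' * inp.B₀ * (α₀ + α₁)))
    (SP5u : ∀ a : J, ∀ α₀ α₁ : ℝ, 0 < α₀ → 0 < α₁ → α₀ + α₁ ≤ cP →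
      ∀ U₀ U' : Site d → Fin d → 𝔸ˣ, (∀ x κ, U₀ x κ ∈ unitaryUnits 𝔸) → (∀ x κ, U' x κ ∈ unitaryUnits 𝔸) →
      ∀ φ : Φ, Adm a φ U₀ α₀ α₁ →
      InAk L (ι a).k (ι a).η α₀ (ι a).Ω U₀ → InAk L (ι a).k (ι a).η α₀ (ι a).Ω (mulCfg U' U₀) → (∀ m, m ≤ (ι a).k → InAx L m ((ι a).Λs m) U₀ (mulCfg U' U₀)) →
      (∀ j, j ≤ (ι a).k → ∀ (z : Site d) (μ : Fin d),
        ((∀ x, InBox (tlo L z j) (thi L z j) x → x ∈ (ι a).Ω j) ∨ (∀ x, InBox (tlo L (z + e μ) j) (thi L (z + e μ) j) x → x ∈ (ι a).Ω j)) →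
        ‖(avgIter L (mulCfg U' U₀) j z μ : 𝔸) - (avgIter L U₀ j z μ : 𝔸)‖ ≤ α₁) →
      (∀ b ∈ {b : Site d × Fin d | SideTouches ((ι a).Ω 0) b.1 b.2}, ‖((U' b.1 b.2 : 𝔸ˣ) : 𝔸) - 1‖ ≤ α₁) →
      ∀ u₁ : Site d → 𝔸ˣ, (∀ x, u₁ x ∈ unitaryUnits 𝔸) → (∀ x, x ∉ (ι a).Ω 0 → u₁ x = 1) → Restr129 L (ι a).k ((ι a).Λs (ι a).k) U₀ u₁ →
      LanF a U₀ φ (ι a).k (mgauge U₀ u₁⁻¹ U') →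
      (∃ A₁ : Site d → Fin d → 𝔸, ∀ j, j ≤ (ι a).k → ∀ (x : Site d) (κ : Fin d), SideTouches ((ι a).Ω j) x κ →
        mgauge U₀ u₁⁻¹ U' x κ = cfgExp (ι a).η A₁ x κ ∧ ‖A₁ x κ‖ ≤ (5 * (d : ℝ) * L * B₈ * (α₀ + α₁)) * ((L : ℝ) ^ j * (ι a).η)⁻¹) →
      ∀ (v w : Site d → 𝔸ˣ) (lam mu : Site d → 𝔸),
      (∀ x, ((gaugeExp lam x : 𝔸ˣ) : 𝔸) = ((v x : 𝔸ˣ) : 𝔸) ∧ IsSelfAdjoint (lam x) ∧ ‖lam x‖ < cu) → (∀ x, x ∉ (ι a).Ω 0 → lam x = 0) →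
      (∀ j, j ≤ (ι a).k → ∀ b ∈ {b : Site d × Fin d | SideTouches ((ι a).Ω j) b.1 b.2}, ((L : ℝ) ^ j * (ι a).η) * ‖covDerivFwd (ι a).η U₀ b.2 lam b.1‖ < cu) →
      (∀ x, ((gaugeExp mu x : 𝔸ˣ) : 𝔸) = ((w x : 𝔸ˣ) : 𝔸) ∧ IsSelfAdjoint (mu x) ∧ ‖mu x‖ < cu) → (∀ x, x ∉ (ι a).Ω 0 → mu x = 0) →
      (∀ j, j ≤ (ι a).k → ∀ b ∈ {b : Site d × Fin d | SideTouches ((ι a).Ω j) b.1 b.2}, ((L : ℝ) ^ j * (ι a).η) * ‖covDerivFwd (ι a).η U₀ b.2 mu b.1‖ < cu) →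
      LanF a U₀ φ (ι a).k (mgauge U₀ v⁻¹ (mgauge U₀ u₁⁻¹ U')) → Restr129 L (ι a).k ((ι a).Λs (ι a).k) U₀ (u₁ * v) →
      LanF a U₀ φ (ι a).k (mgauge U₀ w⁻¹ (mgauge U₀ u₁⁻¹ U')) → Restr129 L (ι a).k ((ι a).Λs (ι a).k) U₀ (u₁ * w) →
      ∀ x, v x = w x)
    -- the ZERO SOURCE (admitted everywhere; its level-`k` gauge condition = the carrier's (1.38) `Landau`)
    (φ₀ : Φ) (hAdm₀ : ∀ a : J, ∀ α₀ α₁ : ℝ, 0 < α₀ → 0 < α₁ → ∀ U₀ : Site d → Fin d → 𝔸ˣ, (∀ x κ, U₀ x κ ∈ unitaryUnits 𝔸) →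
      Adm a φ₀ U₀ α₀ α₁)
    (hLan₀ : ∀ a : J, ∀ U₀ W : Site d → Fin d → 𝔸ˣ,
      LanF a U₀ φ₀ (ι a).k W ↔ IsLandau138W L (ι a).k (ι a).η ((ι a).Ω 0) ((ι a).Λs (ι a).k) U₀ W)
    -- the image lies in the `Ω₀ = ℤᵈ` members; their tower laws at every truncation (`IdxB8Sub.tower_all` at NODE 00's law members)
    (hΩ : ∀ a : J, (ι a).Ω 0 = Set.univ)
    (htw : ∀ a : J, ∀ m, m ≤ (ι a).k → ∀ j, j ≤ m → ∀ y ∈ (ι a).Λs m j, ∀ x, InBox (tlo L y j) (thi L y j) x → x ∈ (ι a).Ω j)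
    -- PROPOSITION 3 AS PRINTED on the IMAGE family (dag-n05-d's `prop3Printed_zdGF3P_map_γ (ι)`, A6: not over all `ZdIdx`), any `C₂ ≤ 2097152(d+1)²L²`
    (hP3 : B8.Prop3Printed d (L : ℝ) C₂ inp B₀β (fun a : J => (zdGF3P 𝔸 L β len (ι a)).toGFData2)) :
    B8.Thm2Printed (fun a : J => (zdGF3HP 𝔸 L β len (ι a)).toGFData) := by
  have hL1 : 1 ≤ L := le_trans (by norm_num) hL
  have hd1 : 1 ≤ d := le_trans (by norm_num) hd2
  have hL' : (1 : ℝ) ≤ L := by exact_mod_cast hL1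
  have hd' : (1 : ℝ) ≤ d := by exact_mod_cast hd1
  have hB₀ : 0 < inp.B₀ := inp.B₀_pos
  have hB₀' : 0 < inp.B₀' := inp.B₀'_pos
  -- Theorem 4's constant `B₈ ≥ B₀`
  have hKB₀ : 0 < B₈ := hB₈
  have hBK : 2 ≤ 5 * (d : ℝ) * L * B₈ := hB
  -- the two instances, the windows
  obtain ⟨c4, hc4, H4⟩ := thm4Body_zdGF3HP_mapJ_γ' (𝔸 := 𝔸) (β := β) (len := len) hd2 hL hB₀ hB₀' hcu hcP hγ' hB₈ hB₀8 hB hγB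
    ι Adm LanF SP5base SP5 SH59src SP5u φ₀ hAdm₀ hLan₀
  obtain ⟨c3, hc3, H3⟩ := hP3
  obtain ⟨cw, hcw, hw⟩ := thm4_windows_γ hd1 hL1 hKB₀ hB₀' hBK
  obtain ⟨cw', hcw', hw'⟩ := thm4_windows_extra (d := d) hL1
  -- constants
  set D : ℝ := 1 + 11 * (d : ℝ) ^ 2 with hD_def
  have hD1 : 1 ≤ D := le_add_of_nonneg_right (by positivity)
  have hD0 : 0 < D := lt_of_lt_of_le one_pos hD1
  have hDne : D ≠ 0 := hD0.ne'
  have hK₁ : 0 < 5 * (d : ℝ) * L * inp.B₀ := by positivity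
  have hK₂ : 0 < 5 * (d : ℝ) * L * B₀β := by positivity
  set B₁ : ℝ := 5 * (d : ℝ) * L * inp.B₀ * D with hB₁_def
  set B₂ : ℝ := 5 * (d : ℝ) * L * B₀β * D with hB₂_def
  have hB₁0 : 0 < B₁ := mul_pos hK₁ hD0
  have hB₂0 : 0 < B₂ := mul_pos hK₂ hD0
  have hK₁D : 0 < 5 * (d : ℝ) * L * B₈ * D := mul_pos (by positivity) hD0
  have hK₁Dne : 5 * (d : ℝ) * L * B₈ * D ≠ 0 := hK₁D.ne'
  -- the threshold: the shifted pair must fit every window; Prop 3's three smallness conditions; the (1.65) window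
  set cT : ℝ := min (min (c4 / D) (min (cw / D) (cw' / D)))
    (min (min (c3 / D) (c3 / (5 * (d : ℝ) * L * B₈ * D))) (1 / (6 * D))) with hcT_def
  have hcT : 0 < cT :=
    lt_min (lt_min (div_pos hc4 hD0) (lt_min (div_pos hcw hD0) (div_pos hcw' hD0)))
      (lt_min (lt_min (div_pos hc3 hD0) (div_pos hc3 hK₁D)) (by positivity))
  refine ⟨B₁, B₂, cT, hB₁0, hB₂0, hcT, ?_⟩
  intro i α₀ α₁ hα₀ hα₁ hs U₀ P hInA hReg hInAAx havg
  have hS0 : 0 < α₀ + α₁ := add_pos hα₀ hα₁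
  -- unpack the thresholds
  have hle : ∀ {c : ℝ}, cT ≤ c / D → D * (α₀ + α₁) ≤ c := by
    intro c hc
    have h1 : α₀ + α₁ ≤ c / D := hs.trans hc
    calc D * (α₀ + α₁) ≤ D * (c / D) := mul_le_mul_of_nonneg_left h1 hD0.le
      _ = c := by field_simp
  have hs4 : D * (α₀ + α₁) ≤ c4 := hle ((min_le_left _ _).trans (min_le_left _ _))
  have hsw : D * (α₀ + α₁) ≤ cw := hle ((min_le_left _ _).trans ((min_le_right _ _).trans (min_le_left _ _)))
  have hsw' : D * (α₀ + α₁) ≤ cw' := hle ((min_le_left _ _).trans ((min_le_right _ _).trans (min_le_right _ _)))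
  have hs3 : D * (α₀ + α₁) ≤ c3 := hle ((min_le_right _ _).trans ((min_le_left _ _).trans (min_le_left _ _)))
  have hs3' : 5 * (d : ℝ) * L * B₈ * D * (α₀ + α₁) ≤ c3 := by
    have h1 : α₀ + α₁ ≤ c3 / (5 * (d : ℝ) * L * B₈ * D) :=
      hs.trans ((min_le_right _ _).trans ((min_le_left _ _).trans (min_le_right _ _)))
    calc 5 * (d : ℝ) * L * B₈ * D * (α₀ + α₁) ≤ 5 * (d : ℝ) * L * B₈ * D * (c3 / (5 * (d : ℝ) * L * B₈ * D)) :=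
        mul_le_mul_of_nonneg_left h1 hK₁D.le
      _ = c3 := by field_simp
  have hs6 : D * (α₀ + α₁) ≤ 1 / 6 := by
    have h1 : α₀ + α₁ ≤ 1 / (6 * D) := hs.trans ((min_le_right _ _).trans (min_le_right _ _))
    calc D * (α₀ + α₁) ≤ D * (1 / (6 * D)) := mul_le_mul_of_nonneg_left h1 hD0.le
      _ = 1 / 6 := by field_simp
  -- the shifted pair `(α₀, α″)`
  set α'' : ℝ := 11 * (d : ℝ) ^ 2 * (α₀ + α₁) + α₁ with hα''_def
  have h11 : 0 ≤ 11 * (d : ℝ) ^ 2 * (α₀ + α₁) := by positivity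
  have h11' : 0 ≤ 11 * (d : ℝ) ^ 2 * α₁ := by positivity
  have hα'' : 0 < α'' := by rw [hα''_def]; linarith only [h11, hα₁]
  have hsum : α₀ + α'' = D * (α₀ + α₁) := by simp only [hα''_def, hD_def]; ring
  have hα₁'' : α₁ ≤ α'' := by rw [hα''_def]; linarith only [h11]
  have h165 : 11 * (d : ℝ) ^ 2 * α₀ + α₁ ≤ α'' := by rw [hα''_def]; linarith only [h11']
  -- windows at the shifted pair
  obtain ⟨g5, g6, g7, g9, g10, -, g14⟩ :=
    hw α₀ α'' hα₀ hα'' (hsum ▸ hsw) (5 * (d : ℝ) * L * B₈ * (α₀ + α'')) (8 * inp.B₀' * (5 * (d : ℝ) * L * B₈) * (α₀ + α'')) rfl rfl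
  obtain ⟨w19, -⟩ := hw' α₀ α'' hα₀ hα'' (hsum ▸ hsw')
  have hsmall₁ : (d : ℝ) * L * α₁ ≤ 1 / 8 := (mul_le_mul_of_nonneg_left hα₁'' (by positivity)).trans w19
  -- the un-scaled windows `C₀α₀ ≤ 1/3`, `2α₀ ≤ c₂′` for (1.65) (from the γ ones, `α₀ ≤ L²α₀`)
  have hL2 : (1 : ℝ) ≤ (L : ℝ) ^ 2 := one_le_pow₀ hL'
  have hαL2 : α₀ ≤ (L : ℝ) ^ 2 * α₀ := le_mul_of_one_le_left hα₀.le hL2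
  have w5 : C0 d * α₀ ≤ 1 / 3 := (mul_le_mul_of_nonneg_left hαL2 (C0_pos d).le).trans g5
  have hα2 : 2 * α₀ ≤ c2' d L := by linarith only [g6, hα₀, hαL2]
  -- the data
  obtain ⟨hP1, h34, hAx⟩ := hInAAx
  subst hP1
  -- the box-form letter from the member's one-end-point letter (both end-blocks inside ⇒ the first is)
  have havgBox : ∀ j, j ≤ (ι i).k → ∀ (z : Site d) (μ : Fin d), (∀ x, InBox (loK L j z) (bondHiK L j z μ) x → x ∈ (ι i).Ω j) →
      ‖(avgIter L (mulCfg P.2.1 P.1.1) j z μ : 𝔸) - (avgIter L P.1.1 j z μ : 𝔸)‖ ≤ α₁ :=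
    fun j hj z μ hg => havg j hj z μ (Or.inl fun x hx => hg x (B8Ineq165AllLevels.inBox_bondBox_of_inBox_block_fst L j z μ hx))
  -- (1.66)₀ on all bonds (Ω₀ = ℤᵈ): (1.65)
  have hpart' : ∀ x : Site d, ∃ j, j ≤ (ι i).k ∧ ∃ y ∈ (ι i).Λs (ι i).k j, InBox (tlo L y j) (thi L y j) x := by
    intro x
    have hx : x ∈ (ι i).Ω 0 := by rw [hΩ i]; trivial
    exact (ι i).hpart x hx
  have hsm : 11 * (d : ℝ) ^ 2 * α₀ + α₁ ≤ 1 / 6 := by linarith only [h165, hα₀, hsum, hs6]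
  have h66 : ∀ b ∈ {b : Site d × Fin d | SideTouches ((ι i).Ω 0) b.1 b.2}, ‖((P.2.1 b.1 b.2 : 𝔸ˣ) : 𝔸) - 1‖ ≤ α'' := by
    intro b _
    have h := norm_pert_sub_one_le_univ hd1 hL (ι i).k (η := (ι i).η) P.1.2 P.2.2 hα₀ w5 hα2 hα₁.le hsm
      (ι i).Ω (ι i).hΩ ((ι i).Λs (ι i).k) (ι i).htower hpart' hInA h34 (hAx (ι i).k le_rfl) havgBox b.1 b.2
    exact h.trans h165
  have h166 : (zdGF3P 𝔸 L β len (ι i)).avgClose166 α'' P.1 P :=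
    ⟨fun j hj z μ hb => (havg j hj z μ hb).trans hα₁'', h66⟩
  -- THEOREM 4 at the shifted pair
  obtain ⟨u, hR, ⟨h137'', hLan, h162⟩, huniq⟩ :=
    H4 i (htw i) () α₀ α'' hα₀ hα'' (hsum ▸ hs4) P.1 P hInA hReg ⟨rfl, h34, hAx⟩ h166
  -- (1.37) at the ORIGINAL α₁: the (1.42) lemma on the canonical exponent of the gauge-fixed field
  have hcs0 : 0 ≤ 5 * (d : ℝ) * L * B₈ * (α₀ + α'') := by positivity
  have hKS0 : 0 ≤ 2 * (L * (5 * (d : ℝ) * L * B₈ * (α₀ + α''))) + 8 * (8 * inp.B₀' * (5 * (d : ℝ) * L * B₈) * (α₀ + α'')) := by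
    positivity
  have hcK : 5 * (d : ℝ) * L * B₈ * (α₀ + α'') ≤
      2 * (L * (5 * (d : ℝ) * L * B₈ * (α₀ + α''))) + 8 * (8 * inp.B₀' * (5 * (d : ℝ) * L * B₈) * (α₀ + α'')) := by
    have h₁ : (1 : ℝ) * (5 * (d : ℝ) * L * B₈ * (α₀ + α'')) ≤ L * (5 * (d : ℝ) * L * B₈ * (α₀ + α'')) :=
      mul_le_mul_of_nonneg_right hL' hcs0
    have h₂ : 0 ≤ 8 * (8 * inp.B₀' * (5 * (d : ℝ) * L * B₈) * (α₀ + α'')) := by positivity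
    linarith only [h₁, h₂, hcs0]
  have h16KS : 16 * (2 * (L * (5 * (d : ℝ) * L * B₈ * (α₀ + α''))) + 8 * (8 * inp.B₀' * (5 * (d : ℝ) * L * B₈) * (α₀ + α''))) ≤ 1 := by
    have h₁ := mul_le_mul_of_nonneg_right hL' hKS0
    linarith only [g7, h₁]
  have hc16 : 16 * (5 * (d : ℝ) * L * B₈ * (α₀ + α'')) ≤ 1 := by linarith only [h16KS, hcK, hKS0]
  have hu : ∀ x, u.1 x ∈ unitaryUnits 𝔸 := u.2.1
  have hW : mgauge P.1.1 u.1 (mgauge P.1.1 u.1⁻¹ P.2.1) = P.2.1 := mgauge_mgauge_inv P.1.1 P.2.1 u.1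
  have hWu : ∀ x κ, mgauge P.1.1 u.1⁻¹ P.2.1 x κ ∈ unitaryUnits 𝔸 := mem_unitaryUnits_of_mgauge_eq P.1.2 P.2.2 hu hW
  have hWA : ∀ j, j ≤ (ι i).k → ∀ y τ, SideTouches ((ι i).Ω j) y τ →
      mgauge P.1.1 u.1⁻¹ P.2.1 y τ = cfgExp (ι i).η (logCfg (ι i).η (mgauge P.1.1 u.1⁻¹ P.2.1)) y τ ∧
        ‖logCfg (ι i).η (mgauge P.1.1 u.1⁻¹ P.2.1) y τ‖ ≤ (5 * (d : ℝ) * L * B₈ * (α₀ + α'')) * ((L : ℝ) ^ j * (ι i).η)⁻¹ :=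
    fun j hj y τ h => ⟨(h162 j hj (y, τ) h).1, (h162 j hj (y, τ) h).2.2⟩
  obtain ⟨hA'sa, hA'eq, hA'zero⟩ := mlogCfg_spec (ι i).hη hL1 (ι i).k P.1.1 hWu hcs0 hc16 (ι i).Ω hWA
  set A' := mlogCfg (ι i).k (ι i).η (ι i).Ω (mgauge P.1.1 u.1⁻¹ P.2.1) with hA'_def
  have hA'bd : ∀ j, j ≤ (ι i).k → ∀ y τ, SideTouches ((ι i).Ω j) y τ →
      mgauge P.1.1 u.1⁻¹ P.2.1 y τ = cfgExp (ι i).η A' y τ ∧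
        ‖A' y τ‖ ≤ (2 * (L * (5 * (d : ℝ) * L * B₈ * (α₀ + α''))) + 8 * (8 * inp.B₀' * (5 * (d : ℝ) * L * B₈) * (α₀ + α''))) *
          ((L : ℝ) ^ j * (ι i).η)⁻¹ := by
    intro j hj y τ h
    obtain ⟨hAA, hWexp⟩ := hA'eq j hj y τ h
    refine ⟨hWexp, ?_⟩
    rw [hAA]
    have hη0 : 0 ≤ (ι i).η := (ι i).hη.le
    exact ((hWA j hj y τ h).2).trans (mul_le_mul_of_nonneg_right hcK (by positivity))
  obtain ⟨hboxP, hclassP⟩ := B8TowerBondsPrinted.ZdIdx.towerBondsP_laws (ι i)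
  have h137 : (zdGF3P 𝔸 L β len (ι i)).C137 α₁ P.1 ((zdGF3P 𝔸 L β len (ι i)).act P u) :=
    B8Eq142KLevelLocalGammaPrime.H42_of_inAx_γ' hd2 (ι i).hη hL (ι i).k P.1.2 hα₀ hα₁ hKS0 g5 g6 g7 g9 g10 hsmall₁ (ι i).Ω (ι i).hΩ (ι i).Λs
      (fun m j => towerBondsP L (ι i).Ω ((ι i).Λs m) j) hboxP hclassP hInA h34 hAx (fun j hj z μ hg => havg j hj z μ hg)
      (fun m W => IsLandau138W L m (ι i).η ((ι i).Ω 0) ((ι i).Λs m) P.1.1 W) (ι i).k (ι i).hk le_rfl (ι i).htower u.1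
      (mgauge P.1.1 u.1⁻¹ P.2.1) A' hu hW hR hLan hA'sa hA'bd hA'zero
  -- PROPOSITION 3 at (α₀, α″, α₂ := c⋆″) for the gauge-fixed field
  have hSD : α₀ + α₁ ≤ D * (α₀ + α₁) := le_mul_of_one_le_left hS0.le hD1
  have hα₀3 : α₀ ≤ c3 := by linarith only [hα₁, hSD, hs3]
  have hα''3 : α'' ≤ c3 := by linarith only [hα₀, hsum, hs3]
  have hcs3 : 5 * (d : ℝ) * L * B₈ * (α₀ + α'') ≤ c3 := by
    rw [hsum, ← mul_assoc]; exact hs3'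
  have hcspos : 0 < 5 * (d : ℝ) * L * B₈ * (α₀ + α'') := by positivity
  have h61 : 2 * (5 * (d : ℝ) * L * B₈ * (α₀ + α'')) ^ 2 + 20 * d * α₀ * (5 * (d : ℝ) * L * B₈ * (α₀ + α'')) +
      2 * C₂ * (5 * (d : ℝ) * L * B₈ * (α₀ + α'')) ^ 2 ≤ α₀ + α'' := by
    set c := 5 * (d : ℝ) * L * B₈ * (α₀ + α'') with hc
    set K := 2 * (L * c) + 8 * (8 * inp.B₀' * (5 * (d : ℝ) * L * B₈) * (α₀ + α'')) with hK
    have hcKle : c ≤ K := hcK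
    have hc0 : 0 ≤ c := hcs0
    have hC : (16 : ℝ) * (131072 * ((d : ℝ) + 1) ^ 2) * (L : ℝ) ^ 2 = 2097152 * ((d : ℝ) + 1) ^ 2 * (L : ℝ) ^ 2 := by ring
    have hC₂' : C₂ ≤ 16 * (131072 * ((d : ℝ) + 1) ^ 2) * (L : ℝ) ^ 2 := by rw [hC]; exact hC₂
    have hmono : 2 * c ^ 2 + 20 * d * α₀ * c + 2 * C₂ * c ^ 2 ≤
        2 * K ^ 2 + 20 * d * α₀ * K + 2 * (16 * (131072 * ((d : ℝ) + 1) ^ 2) * (L : ℝ) ^ 2) * K ^ 2 := by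
      have h1 : c ^ 2 ≤ K ^ 2 := pow_le_pow_left₀ hc0 hcKle 2
      have h2 : 0 ≤ 20 * (d : ℝ) * α₀ := by positivity
      have h3 : 0 ≤ 2 * (16 * (131072 * ((d : ℝ) + 1) ^ 2) * (L : ℝ) ^ 2) := by positivity
      have h4 := mul_le_mul_of_nonneg_left hcKle h2
      have h5 := mul_le_mul_of_nonneg_left h1 h3
      have h6 : 2 * C₂ * c ^ 2 ≤ 2 * (16 * (131072 * ((d : ℝ) + 1) ^ 2) * (L : ℝ) ^ 2) * c ^ 2 :=
        mul_le_mul_of_nonneg_right (by linarith only [hC₂']) (sq_nonneg _)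
      linarith only [h1, h4, h5, h6]
    exact hmono.trans g14
  have hPair : (zdGF3P 𝔸 L β len (ι i)).InAPair α₀ P.1 ((zdGF3P 𝔸 L β len (ι i)).act P u) := by
    show InAk L (ι i).k (ι i).η α₀ (ι i).Ω (mulCfg (mgauge P.1.1 u.1⁻¹ P.2.1) P.1.1)
    have hui : ∀ x, u.1⁻¹ x ∈ U1 𝔸 := fun x => unitaryUnits_le_U1 ((unitaryUnits 𝔸).inv_mem (hu x))
    rw [mulCfg_eq_gaugeAct_of_mgauge_eq hW]
    exact (B8Ineq132.inAk_gaugeAct_iff L (ι i).k (ι i).η α₀ (ι i).Ω hui _).2 h34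
  have h162' : (zdGF3P 𝔸 L β len (ι i)).C162 1 (5 * (d : ℝ) * L * B₈ * (α₀ + α'')) P.1 ((zdGF3P 𝔸 L β len (ι i)).act P u) := by
    intro j hj b hb
    obtain ⟨h1, h2, h3⟩ := h162 j hj b hb
    exact ⟨h1, h2, by rw [one_mul]; exact h3⟩
  obtain ⟨h136, h139⟩ := H3 i α₀ α'' (5 * (d : ℝ) * L * B₈ * (α₀ + α'')) hα₀ hα₀3 hα'' hα''3 hcspos hcs3 h61 P.1
    ((zdGF3P 𝔸 L β len (ι i)).act P u) hInA hReg hPair h162' hLan h137''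
  -- constants: `5dLB₀(α₀ + α″) = B₁(α₀ + α₁)`, `5dL·B₀β·(α₀ + α″) = B₂(α₀ + α₁)`
  have e1 : 5 * (d : ℝ) * (L : ℝ) * inp.B₀ * (α₀ + α'') = B₁ * (α₀ + α₁) := by
    rw [hsum, hB₁_def]; ring
  have e2 : 5 * (d : ℝ) * (L : ℝ) * B₀β * (α₀ + α'') = B₂ * (α₀ + α₁) := by rw [hsum, hB₂_def]; ring
  obtain ⟨h136a, h136g, h136h⟩ := h136
  obtain ⟨h139j, h139l⟩ := h139
  refine ⟨u, hR, ⟨⟨fun j hj b hb => ?_, by rw [← e1]; exact h136g, by rw [← e2]; exact h136h⟩, h137, hLan,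
    ⟨by rw [← e1]; exact h139j, by rw [← e1]; exact h139l⟩⟩, ?_⟩
  · obtain ⟨h1, h2, h3⟩ := h136a j hj b hb
    exact ⟨h1, h2, by rw [← e1]; exact h3⟩
  -- uniqueness: Theorem 4's, since (1.36) at `B₁(α₀ + α₁) = B₁′(α₀ + α″)` is (1.62) there and (1.37) is monotone in α₁
  · intro u' hR' h136' h137' hLan' _
    refine huniq u' hR' ?_ hLan' ?_
    · intro j hj c hc
      have hmono : 2 * (d : ℝ) * L * α₁ ≤ 2 * d * L * α'' := mul_le_mul_of_nonneg_left hα₁'' (by positivity)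
      exact (h137' j hj c hc).trans_le hmono
    · intro j hj b hb
      obtain ⟨h1, h2, h3⟩ := h136'.1 j hj b hb
      refine ⟨h1, h2, ?_⟩
      have e1' : B₁ * (α₀ + α₁) = 5 * (d : ℝ) * L * inp.B₀ * (α₀ + α'') := by rw [hsum, hB₁_def]; ring
      have hle : 5 * (d : ℝ) * L * inp.B₀ * (α₀ + α'') ≤ 5 * (d : ℝ) * L * B₈ * (α₀ + α'') := by
        have h₁ : inp.B₀ ≤ B₈ := hB₀8
        have h₂ : 0 ≤ 5 * (d : ℝ) * L := by positivity
        have h₃ : 0 ≤ α₀ + α'' := by positivity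
        exact mul_le_mul_of_nonneg_right (mul_le_mul_of_nonneg_left h₁ h₂) h₃
      have hw0 : 0 ≤ ((L : ℝ) ^ j * (ι i).η)⁻¹ := inv_nonneg.2 (mul_nonneg (pow_nonneg (Nat.cast_nonneg _) _) (ι i).hη.le)
      exact h3.trans (mul_le_mul_of_nonneg_right (e1'.le.trans hle) hw0)

end Thm2
#print axioms thm2Printed_zdGF3HP_mapJ_γ'

end Literature.MathematicalPhysics.QuantumFieldTheory.Balaban1983to89.B8Thm2ZdGF3PMapGammaPrime

end
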